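import Summits.QuantumFields.BalabanUV.Beta.FP.HorizontalRemainderPerfect
import Summits.QuantumFields.BalabanUV.Beta.FP.HorizontalTailAssemblyCov

/-!
# `BalabanUV.Beta.FP.HorizontalRemainderPerfectCov` — road «FP» for binder row D1, row GAMMA-8 under RULING R-FP-32 (repair (R2) of FINDING F-d1leaf01g10-1):
# THE γ-END OF RECORD WITH ITS TRANSPORT SIDE DISCHARGED, RE-CUT ON THE PRINTED REFLECTION COVARIANCE — every theorem of `FP/HorizontalRemainderPerfect` with the
# unfillable evenness letter `heven` REPLACED by `hcov : AxisReflectionCovariant (flipK K)` (road FP's N3 ∕ the wall's hR shape) and the defect constant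
# `U₀ᴱ ↦ U₀ᴱ + U₁ᴱ`, `U₁ᴱ := 64·(80C)·(c·e^δ∕δ)`; everything else VERBATIM

HONEST DEPENDENCY (page 1, mandatory): continuum YM on T⁴ ⇐ BetaPertH ∧ nine spine estimates (0/9 proved); BetaPertH ⇐ (D1) ∧ (D4) ∧
CAP+tail; G-an2-4 gates asym, D1 and NE2/3/4.  HONEST FRAMING (cell contract, verbatim): «discharging `BetaPertH` makes Bałaban's UV
stability UNCONDITIONAL — a real constructive-QFT result; it is NOT the continuum limit and NOT the Clay problem.»  THIS MODULE is [folklore]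
composition BY NAME of: the γ-END `FP/HorizontalRemainderTotal.abs_secondMoment_sub_window_le_of_remainder` (owner, gen 7), the re-cut (a)-socket
`FP/HorizontalTailAssemblyCov.hasSum_truncatedTransport_cov` (leaf-01-g10, R-FP-32 (C-up): (K6) + `AxisReflectionCovariant (flipK K)` + (K0) + exp-ℓ¹ transport letters ⟹
`HasSum (Xtr·v_μ·v_ν) (g N + E₀)`, `|E₀| ≤ U₀ᴱ + U₁ᴱ`), the (pp→rem) glue `FP/HorizontalBookkeepingPaired.rem_of_pp`, `FP/HorizontalEndNat.hasym_of_horizontal_nat`, and the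
road's transport letters `FP/PerfectColumnTransportTail.transportLetters_perfCol`.  No `def`, no `def … : Prop`, nothing cited, 0 sorry.  0 estimates of Bałaban's
objects; 0∕4 row-D1 binders; NOT hbook-discharged (the kernel letters of `K = PiBF`, (rem)∕(pp), `hgerm`, KER, X1 remain), NOT hasym, NOT D1, NOT BetaPertH,
NOT continuum, NOT Clay.

ABSOLUTE RULE (cell charter, verbatim): «No internally-minted statement may enter as a cited fact. Every hypothesis is either kernel-proved in this
package or a verbatim quotation of a PUBLISHED theorem with page reference. The manuscript(s) under audit are NOT citable for their own disputed
steps — they are the thing under adjudication; programme-internal (2001/route/tribunal) claims are never citable.»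

WHY (E-FP-8-2 ∕ R-FP-32).  `HorizontalRemainderPerfect.{hasSum_truncatedTransport_of_expL1, end_of_remainder_expL1, end_of_pp_expL1, hbook∕hasym_perfect_of_remainder∕_of_pp}`
carry `heven : ∀ c e t, K c e (−t) = K c e t`; `FP/EvenKernelNoGo` shows that letter, together with the reflection covariance the road proves and (K6), forces every
off-diagonal channel of `K` to vanish (and `hgerm`'s slope to be `0`) — a correct END with an unfillable socket.  The repair of record keeps the (T1) `m₁`-terms
(`HorizontalBookkeepingCov.t1Defect`) and bounds them by the slab∕shell letter `TruncatedFirstMoment` (`A₁ = 80C`): the cost is the ONE extra N-free constant `U₁ᴱ`.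

CONTENT (signatures = the landed ones with `heven ↦ hcov`, `U₀ᴱ ↦ U₀ᴱ + U₁ᴱ`):
* §1 **`end_of_remainder_expL1_cov`** ∕ **`end_of_pp_expL1_cov`** — the γ-END with (a) discharged, (rem) ∕ (pp) currency.
* §2 (`d = 3`, `2 ≤ Lc`, the perfect columns, every `m ≥ 1`) **`hbook_perfect_of_remainder_cov`**, **`hasym_perfect_of_remainder_cov`**, **`hbook_perfect_of_pp_cov`**,
  **`hasym_perfect_of_pp_cov`**.
Unit `b2b-balaban-beta-d1-formalise-leaf-01` (gen 10), drafted for the road OWNER d1-p3 (who ruled these twins his; filed by whichever seat the owner names).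
-/

noncomputable section

namespace Summit.QuantumFields.BalabanUV.Beta.FP.HorizontalRemainderPerfectCov

open Finset Filter Topology
open Literature.Probability.LatticeModels (box annulus)
open Literature.MathematicalPhysics.QuantumFieldTheory.Balaban1983to89
open Literature.MathematicalPhysics.QuantumFieldTheory.Balaban1983to89.Beta
open B12Sec2to5 (l1)
open DyadicShell (Pt supNorm)
open PolarizationSign (AxisReflectionCovariant)
open OneStepKernelFamily (flipK)
open DecimatedMomentSummable (ConstReproSum LinReproSum AbsMoment₂)
open DressedMomentNormalisation (EKer dressedEntry)
open Summit.QuantumFields.BalabanUV.Beta.GAN24.CombesThomas (sfStep smStep)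
open Summit.QuantumFields.BalabanUV.Beta.FP.PerfectObjectsT (KPerf)
open Summit.QuantumFields.BalabanUV.Beta.FP.TransportInfinityM (colOf)
open Summit.QuantumFields.BalabanUV.Beta.FP.HorizontalBookkeeping (truncK t0Defect)
open Summit.QuantumFields.BalabanUV.Beta.FP.HorizontalBookkeepingCov (t1Defect)
open Summit.QuantumFields.BalabanUV.Beta.FP.HorizontalBookkeepingTail (nonneg_of_decay)
open Summit.QuantumFields.BalabanUV.Beta.FP.HorizontalTailAssemblyCov (hasSum_truncatedTransport_cov)
open Summit.QuantumFields.BalabanUV.Beta.FP.HorizontalRemainderTotal (abs_secondMoment_sub_window_le_of_remainder)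
open Summit.QuantumFields.BalabanUV.Beta.FP.HorizontalBookkeepingPaired (rem_of_pp)
open Summit.QuantumFields.BalabanUV.Beta.FP.HorizontalEndNat (hasym_of_horizontal_nat)
open Summit.QuantumFields.BalabanUV.Beta.FP.PerfectColumnTransportTail (transportLetters_perfCol)

/-! ## §1 The γ-END with (a) discharged on (5.7)-covariance -/

/-- [folklore] **THE γ-END WITH (a) DISCHARGED, (rem) CURRENCY, COVARIANT FORM**: the letters of `HorizontalTailAssemblyCov.hasSum_truncatedTransport_cov` — (K6), the printed
reflection covariance `AxisReflectionCovariant (flipK K)` (in place of evenness), the Ward ∕ (T0) letter, the exp-ℓ¹ transport letters — and the ONE remainder letter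
`∀ S, Σ_{v∈S} ‖v‖∞²·|T μ ν v − Xtr v| ≤ Bρ` give `Summable (T μ ν·v_μ·v_ν)` and `|secondMoment T μ ν − g N| ≤ (U₀ᴱ + U₁ᴱ) + Bρ`. -/
theorem end_of_remainder_expL1_cov {K w : EKer 4} {C c δ : ℝ} {N : ℕ} (hN : 1 ≤ N) (hδ : 0 < δ)
    (hK : ∀ c' e (t : Pt), |K c' e t| ≤ C / ((supNorm t : ℝ) + 1) ^ 6)
    (hcov : AxisReflectionCovariant (flipK K))
    (hK0 : ∀ c' e, HasSum (K c' e) 0)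
    (Cw : Fin 4 → Fin 4 → Fin 4 → ℝ)
    (hw0 : ∀ κ l, ConstReproSum N (w κ l) (if κ = l then (((N : ℝ) ^ (4 + 1))⁻¹) else 0))
    (hw1 : ∀ κ l, LinReproSum N (w κ l) (Cw κ l))
    (hwE : ∀ κ l, Summable fun x => Real.exp (δ / N * l1 x) * |w κ l x|)
    (hwEb : ∀ κ l, ∑' x, Real.exp (δ / N * l1 x) * |w κ l x| ≤ c / N) (μ ν : Fin 4)
    {T : Fin 4 → Fin 4 → Pt → ℝ} {Bρ : ℝ}
    (hrem : ∀ S : Finset Pt, ∑ v ∈ S, (supNorm v : ℝ) ^ 2 *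
      |T μ ν v - (N : ℝ) ^ 8 * dressedEntry w (truncK K N) ((N : ℤ) • v) μ ν| ≤ Bρ) :
    Summable (fun v : Pt => T μ ν v * (v μ : ℝ) * (v ν : ℝ)) ∧
      |B12Beta.secondMoment T μ ν - ∑ z ∈ annulus 4 0 N, K μ ν z * (z μ : ℝ) * (z ν : ℝ)|
        ≤ (16 * (40 * C) * (2 * (2 * c * Real.exp δ / δ ^ 2) + 2 * (c * Real.exp δ / δ) * (c * Real.exp δ / δ))
            + 64 * (80 * C) * (c * Real.exp δ / δ)) + Bρ := by
  obtain ⟨ha, hE⟩ := hasSum_truncatedTransport_cov hN hδ hK hcov hK0 Cw hw0 hw1 hwE hwEb μ ν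
  exact abs_secondMoment_sub_window_le_of_remainder
    (Xtr := fun v : Pt => (N : ℝ) ^ 8 * dressedEntry w (truncK K N) ((N : ℤ) • v) μ ν) ha hE hrem

/-- [folklore] **THE γ-END WITH (a) DISCHARGED, (pp) CURRENCY, COVARIANT FORM**: as `end_of_remainder_expL1_cov` with the pointwise paired letter
`|T μ ν v − Xtr v| ≤ B·e^{−δ′‖v‖∞}` (`0 < δ′`, `0 ≤ B`) in place of (rem) — `HorizontalBookkeepingPaired.rem_of_pp` BY NAME. -/
theorem end_of_pp_expL1_cov {K w : EKer 4} {C c δ : ℝ} {N : ℕ} (hN : 1 ≤ N) (hδ : 0 < δ)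
    (hK : ∀ c' e (t : Pt), |K c' e t| ≤ C / ((supNorm t : ℝ) + 1) ^ 6)
    (hcov : AxisReflectionCovariant (flipK K))
    (hK0 : ∀ c' e, HasSum (K c' e) 0)
    (Cw : Fin 4 → Fin 4 → Fin 4 → ℝ)
    (hw0 : ∀ κ l, ConstReproSum N (w κ l) (if κ = l then (((N : ℝ) ^ (4 + 1))⁻¹) else 0))
    (hw1 : ∀ κ l, LinReproSum N (w κ l) (Cw κ l))
    (hwE : ∀ κ l, Summable fun x => Real.exp (δ / N * l1 x) * |w κ l x|)
    (hwEb : ∀ κ l, ∑' x, Real.exp (δ / N * l1 x) * |w κ l x| ≤ c / N) (μ ν : Fin 4)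
    {T : Fin 4 → Fin 4 → Pt → ℝ} {B δ' : ℝ} (hδ' : 0 < δ') (hB : 0 ≤ B)
    (hpp : ∀ v : Pt, |T μ ν v - (N : ℝ) ^ 8 * dressedEntry w (truncK K N) ((N : ℤ) • v) μ ν|
      ≤ B * Real.exp (-δ' * (supNorm v : ℝ))) :
    Summable (fun v : Pt => T μ ν v * (v μ : ℝ) * (v ν : ℝ)) ∧
      |B12Beta.secondMoment T μ ν - ∑ z ∈ annulus 4 0 N, K μ ν z * (z μ : ℝ) * (z ν : ℝ)|
        ≤ (16 * (40 * C) * (2 * (2 * c * Real.exp δ / δ ^ 2) + 2 * (c * Real.exp δ / δ) * (c * Real.exp δ / δ))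
            + 64 * (80 * C) * (c * Real.exp δ / δ))
          + B * (1 + 9600 * Real.exp (δ' / 2) * (2 / δ') ^ 6) :=
  end_of_remainder_expL1_cov hN hδ hK hcov hK0 Cw hw0 hw1 hwE hwEb μ ν
    (rem_of_pp (T := T) (Xtr := fun v : Pt => (N : ℝ) ^ 8 * dressedEntry w (truncK K N) ((N : ℤ) • v) μ ν) hδ' hB hpp)

/-! ## §2 The perfect minimiser columns: `hbook` and `hasym` at the road's own transport, m-uniformly, covariant form -/

section Perfect

variable {Lc : ℕ} [NeZero Lc]

/-- **`hbook` AT THE PERFECT COLUMNS FROM THREE KERNEL LETTERS AND THE REMAINDER LETTER, COVARIANT FORM** [our object] (`d = 3`, `2 ≤ Lc`): for a transported kernel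
`K` with sextic decay, the PRINTED REFLECTION COVARIANCE `AxisReflectionCovariant (flipK K)` and `HasSum (K c e) 0`, and ANY family `T m` of coarse kernels whose remainder
against the truncated transport of `K` by the perfect minimiser columns at blocking `Lc^m` obeys the m-UNIFORM letter (rem) with constant `Bρ`, there is an m-FREE `U₀ ≥ 0`
with `|secondMoment (T m) μ ν − Σ_{0<‖z‖∞≤Lc^m} K μ ν z·z_μ·z_ν| ≤ U₀ + Bρ` for every `m ≥ 1`.  (`HorizontalRemainderPerfect.hbook_perfect_of_remainder` with `heven ↦ hcov`.) -/
theorem hbook_perfect_of_remainder_cov (hLc : 2 ≤ Lc) {K : EKer 4} {C : ℝ}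
    (hK : ∀ c' e (t : Pt), |K c' e t| ≤ C / ((supNorm t : ℝ) + 1) ^ 6)
    (hcov : AxisReflectionCovariant (flipK K)) (hK0 : ∀ c' e, HasSum (K c' e) 0)
    {T : ℕ → Fin 4 → Fin 4 → Pt → ℝ} (μ ν : Fin 4) {Bρ : ℝ}
    (hrem : ∀ m : ℕ, 1 ≤ m → ∀ S : Finset Pt, ∑ v ∈ S, (supNorm v : ℝ) ^ 2 *
      |T m μ ν v - ((Lc ^ m : ℕ) : ℝ) ^ 8 * dressedEntry (colOf (KPerf (d := 3) Lc (sfStep Lc) (smStep 3 Lc) m))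
          (truncK K (Lc ^ m)) (((Lc ^ m : ℕ) : ℤ) • v) μ ν| ≤ Bρ) :
    ∃ U₀ : ℝ, 0 ≤ U₀ ∧ ∀ m : ℕ, 1 ≤ m →
      (Summable fun v : Pt => T m μ ν v * (v μ : ℝ) * (v ν : ℝ)) ∧
      |B12Beta.secondMoment (T m) μ ν - ∑ z ∈ annulus 4 0 (Lc ^ m), K μ ν z * (z μ : ℝ) * (z ν : ℝ)| ≤ U₀ + Bρ := by
  obtain ⟨δ, c, hδ, hc, hL⟩ := transportLetters_perfCol (Lc := Lc) hLc
  have hC : 0 ≤ C := nonneg_of_decay hK μ ν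
  refine ⟨16 * (40 * C) * (2 * (2 * c * Real.exp δ / δ ^ 2) + 2 * (c * Real.exp δ / δ) * (c * Real.exp δ / δ))
      + 64 * (80 * C) * (c * Real.exp δ / δ), by positivity, fun m hm => ?_⟩
  obtain ⟨hw0, ⟨Cw, hw1⟩, -, hwE, hwEb⟩ := hL m hm
  have hN : 1 ≤ Lc ^ m := Nat.one_le_pow m Lc (Nat.pos_of_ne_zero (NeZero.ne Lc))
  exact end_of_remainder_expL1_cov hN hδ hK hcov hK0 Cw hw0 hw1 hwE hwEb μ ν (hrem m hm)

/-- **`hasym` AT THE PERFECT COLUMNS, COVARIANT FORM** [our object] (`d = 3`, `2 ≤ Lc`): `hbook_perfect_of_remainder_cov` plus the windowed germ letter `hgerm` give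
an m-FREE `U₀ ≥ 0` with `|secondMoment (T m) μ ν − m·(s·log Lc)| ≤ (U₀ + Bρ) + Cg + |c₀|` for every `m ≥ 1` — the bounded (ASYMP) hypothesis of
`FixedPointIdentification` for `f m := secondMoment (T m) μ ν`, now with a FILLABLE symmetry letter. -/
theorem hasym_perfect_of_remainder_cov (hLc : 2 ≤ Lc) {K : EKer 4} {C : ℝ}
    (hK : ∀ c' e (t : Pt), |K c' e t| ≤ C / ((supNorm t : ℝ) + 1) ^ 6)
    (hcov : AxisReflectionCovariant (flipK K)) (hK0 : ∀ c' e, HasSum (K c' e) 0)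
    {T : ℕ → Fin 4 → Fin 4 → Pt → ℝ} (μ ν : Fin 4) {Bρ : ℝ}
    (hrem : ∀ m : ℕ, 1 ≤ m → ∀ S : Finset Pt, ∑ v ∈ S, (supNorm v : ℝ) ^ 2 *
      |T m μ ν v - ((Lc ^ m : ℕ) : ℝ) ^ 8 * dressedEntry (colOf (KPerf (d := 3) Lc (sfStep Lc) (smStep 3 Lc) m))
          (truncK K (Lc ^ m)) (((Lc ^ m : ℕ) : ℤ) • v) μ ν| ≤ Bρ)
    {s c₀ Cg : ℝ}
    (hgerm : ∀ M : ℕ, 1 ≤ M → |∑ z ∈ annulus 4 0 M, K μ ν z * (z μ : ℝ) * (z ν : ℝ) - (s * Real.log M + c₀)| ≤ Cg) :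
    ∃ U₀ : ℝ, 0 ≤ U₀ ∧ ∀ m : ℕ, 1 ≤ m →
      |B12Beta.secondMoment (T m) μ ν - (m : ℝ) * (s * Real.log Lc)| ≤ (U₀ + Bρ) + Cg + |c₀| := by
  obtain ⟨U₀, hU₀, hbook⟩ := hbook_perfect_of_remainder_cov hLc hK hcov hK0 (T := T) μ ν hrem
  have hLc1 : 1 ≤ Lc := le_trans (by norm_num) hLc
  exact ⟨U₀, hU₀, hasym_of_horizontal_nat (f := fun m => B12Beta.secondMoment (T m) μ ν)
    (g := fun M => ∑ z ∈ annulus 4 0 M, K μ ν z * (z μ : ℝ) * (z ν : ℝ)) hLc1 (fun m hm => (hbook m hm).2) hgerm⟩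

/-- **`hbook` AT THE PERFECT COLUMNS FROM THE POINTWISE PAIRED LETTER (pp), COVARIANT FORM** [our object] (`d = 3`, `2 ≤ Lc`). -/
theorem hbook_perfect_of_pp_cov (hLc : 2 ≤ Lc) {K : EKer 4} {C : ℝ}
    (hK : ∀ c' e (t : Pt), |K c' e t| ≤ C / ((supNorm t : ℝ) + 1) ^ 6)
    (hcov : AxisReflectionCovariant (flipK K)) (hK0 : ∀ c' e, HasSum (K c' e) 0)
    {T : ℕ → Fin 4 → Fin 4 → Pt → ℝ} (μ ν : Fin 4) {B δ' : ℝ} (hδ' : 0 < δ') (hB : 0 ≤ B)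
    (hpp : ∀ m : ℕ, 1 ≤ m → ∀ v : Pt,
      |T m μ ν v - ((Lc ^ m : ℕ) : ℝ) ^ 8 * dressedEntry (colOf (KPerf (d := 3) Lc (sfStep Lc) (smStep 3 Lc) m))
          (truncK K (Lc ^ m)) (((Lc ^ m : ℕ) : ℤ) • v) μ ν| ≤ B * Real.exp (-δ' * (supNorm v : ℝ))) :
    ∃ U₀ : ℝ, 0 ≤ U₀ ∧ ∀ m : ℕ, 1 ≤ m →
      (Summable fun v : Pt => T m μ ν v * (v μ : ℝ) * (v ν : ℝ)) ∧
      |B12Beta.secondMoment (T m) μ ν - ∑ z ∈ annulus 4 0 (Lc ^ m), K μ ν z * (z μ : ℝ) * (z ν : ℝ)|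
        ≤ U₀ + B * (1 + 9600 * Real.exp (δ' / 2) * (2 / δ') ^ 6) :=
  hbook_perfect_of_remainder_cov hLc hK hcov hK0 (T := T) μ ν fun m hm =>
    rem_of_pp (T := T m) (Xtr := fun v : Pt => ((Lc ^ m : ℕ) : ℝ) ^ 8 *
      dressedEntry (colOf (KPerf (d := 3) Lc (sfStep Lc) (smStep 3 Lc) m)) (truncK K (Lc ^ m)) (((Lc ^ m : ℕ) : ℤ) • v) μ ν)
      hδ' hB (hpp m hm)

/-- **`hasym` AT THE PERFECT COLUMNS FROM (pp) + `hgerm`, COVARIANT FORM** [our object] (`d = 3`, `2 ≤ Lc`). -/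
theorem hasym_perfect_of_pp_cov (hLc : 2 ≤ Lc) {K : EKer 4} {C : ℝ}
    (hK : ∀ c' e (t : Pt), |K c' e t| ≤ C / ((supNorm t : ℝ) + 1) ^ 6)
    (hcov : AxisReflectionCovariant (flipK K)) (hK0 : ∀ c' e, HasSum (K c' e) 0)
    {T : ℕ → Fin 4 → Fin 4 → Pt → ℝ} (μ ν : Fin 4) {B δ' : ℝ} (hδ' : 0 < δ') (hB : 0 ≤ B)
    (hpp : ∀ m : ℕ, 1 ≤ m → ∀ v : Pt,
      |T m μ ν v - ((Lc ^ m : ℕ) : ℝ) ^ 8 * dressedEntry (colOf (KPerf (d := 3) Lc (sfStep Lc) (smStep 3 Lc) m))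
          (truncK K (Lc ^ m)) (((Lc ^ m : ℕ) : ℤ) • v) μ ν| ≤ B * Real.exp (-δ' * (supNorm v : ℝ)))
    {s c₀ Cg : ℝ}
    (hgerm : ∀ M : ℕ, 1 ≤ M → |∑ z ∈ annulus 4 0 M, K μ ν z * (z μ : ℝ) * (z ν : ℝ) - (s * Real.log M + c₀)| ≤ Cg) :
    ∃ U₀ : ℝ, 0 ≤ U₀ ∧ ∀ m : ℕ, 1 ≤ m →
      |B12Beta.secondMoment (T m) μ ν - (m : ℝ) * (s * Real.log Lc)|
        ≤ (U₀ + B * (1 + 9600 * Real.exp (δ' / 2) * (2 / δ') ^ 6)) + Cg + |c₀| := by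
  obtain ⟨U₀, hU₀, hbook⟩ := hbook_perfect_of_pp_cov hLc hK hcov hK0 (T := T) μ ν hδ' hB hpp
  have hLc1 : 1 ≤ Lc := le_trans (by norm_num) hLc
  exact ⟨U₀, hU₀, hasym_of_horizontal_nat (f := fun m => B12Beta.secondMoment (T m) μ ν)
    (g := fun M => ∑ z ∈ annulus 4 0 M, K μ ν z * (z μ : ℝ) * (z ν : ℝ)) hLc1 (fun m hm => (hbook m hm).2) hgerm⟩

end Perfect

end Summit.QuantumFields.BalabanUV.Beta.FP.HorizontalRemainderPerfectCov

end
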